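import Summits.BirchSwinnertonDyer.Rank1Residual.X10.SelmerCompanions
import Summits.BirchSwinnertonDyer.Rank1Residual.GaloisImage.SelmerLocalConditionTamagawaFree
import Literature.NumberTheory.EllipticCurves.BSDRankZeroDensityProofs
import Literature.NumberTheory.EllipticCurves.BSDSelmerCMPConverseRankOneProofs
import Literature.NumberTheory.EllipticCurves.CongruentNumberCurveSupersingular
import Literature.NumberTheory.EllipticCurves.SelmerCorankControlRatProofs
import Literature.NumberTheory.EllipticCurves.OpenImageMazurAssemblyProofs
import HarnessLib

/-!
# Selmer COMPANIONS at TAMAGAWA-FREE level: `#Sel^(p)(A/ℚ) = #Sel^(p)(E/ℚ)` for `p`-congruent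
# curves both good at `p` with `p ∤ Tam(E) · Tam(A)` — the consumers (C-i), (C-ii), (C-iii) of the
# SPEC (L1) (cell `b2b-bsdres`, unit `b2b-bsdres-x10` = N2 class lead, GEN 29; TOOL — theorems only,
# no definition, no named fact of its own, nothing booked)

HONEST FRAMING (run/shared/lean/b2b/bsd-rank1-residual/, verbatim in every file): the goal of the
cell is to DELETE the COMBINATION-SHAPED residual classes of the Birch–Swinnerton-Dyer formula for
ALL analytic-rank `≤ 1` elliptic curves over `ℚ` — "full BSD formula for every rank `≤ 1` curve in
class `C`" assembled STRICTLY from published theorems — so that the rank-`≤ 1` remainder becomes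
exactly the CONSTRUCTION-SHAPED classes, which are TYPED (missing-input `Prop`s), NOT attempted.
This is not "finishing BSD". Class X10b (= N2) keeps its label CONSTRUCTION-SHAPED (NEEDS `X_A3`,
referee R82.3 / RESIDUAL-MAP §I N2); this file is a TOOL; no mark / label / tier / count moves.

## What

x10 GEN 27 landed the two-sided companion tool `SelmerCompanions.natCard_selmerGroup_eq_of_congr_of_agree[_rat]`
(`#Sel^(p)(E′) = #Sel^(p)(E)` once the local conditions agree along `θ : E′[p] ⥲ E[p]` at every
place of a finite set `S`), x10 GEN 28 wrote the SPEC (L1) (`HOME/class-closure/N2/L1-SPEC-x10g28.md`)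
for the one missing local lemma, and team n1011 (seat p04 GEN 16, row T-URTAM) proved it:
`InertiaDivisible.selmerLocalKer_iff_h1Equiv_of_not_dvd_localTamagawaNumber` — at a finite place
`v ∤ p` with `p ∤ c_v(E)` and `p ∤ c_v(E′)` (ANY reduction types) the local conditions agree
(Milne *ADT* I Prop. 3.8: both are the unramified condition). This file assembles the consumers:

* §1 `localTamagawaNumber_dvd_tamagawaProduct` — `c_v(E) ∣ Tam(E) = ∏_v c_v(E)`, so `p ∤ Tam(E) ⟹ p ∤ c_v(E)`.
* §2 **(C-i) over a number field, fact-free off `p`**: `natCard_selmerGroup_eq_of_congr_of_not_dvd_tamagawaProduct`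
  — `p` odd, `θ : E′[p] ⥲ E[p]` `Γ_K`-equivariant, `p ∤ Tam(E)`, `p ∤ Tam(E′)`, and an agreement
  hypothesis at the places ABOVE `p` only ⟹ `#Sel^(p)(E′/K) = #Sel^(p)(E/K)`.  No set `S`.
* §3 **(C-i) over `ℚ`**: `natCard_selmerGroup_eq_of_congr_of_not_dvd_tamagawaProduct_rat` — both
  curves GOOD above `p` (the agreement there is Mazur–Rubin 2015 Thm. 3.1 (iv)(b), the tree's named
  fact `hMR`), `p ∤ Tam(E)`, `p ∤ Tam(E′)` ⟹ `#Sel^(p)(E′/ℚ) = #Sel^(p)(E/ℚ)`; integer-model form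
  `…_of_map` (`E = E₀ ⊗ ℚ`, `E′ = F₀ ⊗ ℚ`, `p ∤ Δ(E₀)`, `p ∤ Δ(F₀)` — the record vocabulary).
  CONDITIONAL on `hMR` only.
* §4 **(C-iii) the UNIT road transfers along Tamagawa-free congruences**: with `#Sel^(p)(E/ℚ) = 1`
  (a certified full `p`-descent, the binder `hSel3` of the `X10/UnitRoad*` records at `p = 3`), EVERY
  such `E′` has `#Sel^(p)(E′/ℚ) = 1`, hence `rank E′(ℚ) = 0`, `E′(ℚ)[p] = 0`, `Ш(E′/ℚ)[p^∞] = 0`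
  (`rank_zero_of_congr_of_natCard_selmerGroup_eq_one_rat`) — a kernel statement about every
  Tamagawa-`3`-free good-at-`3` curve `3`-congruent to one of the 77 UNIT cells of N2 (and to
  `118810q1` once its `S⁰ = 0` is a kernel fact), in Cremona's table or beyond it (x10 GEN 27 found
  > 2 000 such curves of conductor up to `10^28` in the dual Hesse families, TRIVIAL-ROADS memo §4).
* §5 **(C-ii) the Ш-cell NO-GO**: with `#Sel^(p)(E/ℚ) ≠ 1` no such `E′` is a unit curve
  (`natCard_selmerGroup_ne_one_of_congr_rat`); sharper, with `#Sel^(p)(E/ℚ) = p²` and `E[p]`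
  irreducible (so `E′[p]` is, and `E′(ℚ)[p] = 0`): a rank-`0` such `E′` has `#Ш(E′/ℚ)[p] = p²`
  (`natCard_sha_torsion_eq_sq_of_congr_of_rank_zero_rat`) — the six N2 Ш-cells (`24649b1`, `264992dm1`,
  `288800ba1`, `305762d1`, `322624k1`, `453152bq1`: `T_E = ∅`, `dim Sel₃(E) = 2` EXACT by x10b) have no
  unit partner anywhere, and every rank-`0` Tamagawa-`3`-free good-at-`3` congruent curve carries
  `Ш[3] ≅ (ℤ/3)²` (memo (C4); census: `Ш_an = 9, 9, 9, 9, 225` on the computable members).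

BINDERS (displayed by any record using this file): `hMR` (Mazur–Rubin 2015, named fact, `ℚ`-versions
only), `θ, hθ` (the congruence — EVIDENCE, e.g. a KO-certified row or a Hesse-family member), the
census values `#Sel^(p)(E) = 1 / = p²` (x10b / cc-eng-4 descent lines), `p ∤ Tam(·)` (Tate's algorithm
certificates, `UnitRoadTamCert*`). Nothing here is a class statement; N2 = X10b NEEDS `X_A3` unchanged.

## References

* [MazurRubin2015SelmerCompanions] B. Mazur, K. Rubin, *Selmer companion curves*, TAMS 367 (2015), Thm. 3.1.
* [MazurRubin2004] B. Mazur, K. Rubin, *Kolyvagin systems*, Mem. AMS 799 (2004), §2.3.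
* [MilneADT2006] J. S. Milne, *Arithmetic Duality Theorems*, 2nd ed., I Prop. 3.8, Rem. 3.10.
* [SchaeferStoll2004] E. F. Schaefer, M. Stoll, *How to do a p-descent*, TAMS 356 (2004), L. 3.1, Prop. 3.2.
* [SilvermanAEC2009] J. H. Silverman, *AEC*, Thm. X.4.2, Cor. VII.6.2.
* HOME/class-closure/N2/{L1-SPEC-x10g28.md §3, TRIVIAL-ROADS-x10g27.md}; HOME/X10-AUDIT.md §§33–35.
-/

set_option autoImplicit false

noncomputable section

open scoped Classical

open WeierstrassCurve Literature.NumberTheory.EllipticCurves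
  Literature.NumberTheory.GaloisRepresentations Field NumberField IsDedekindDomain
open Summit.BirchSwinnertonDyer.Rank1Residual.X10.SelmerCompanions
open Summit.BirchSwinnertonDyer.Rank1Residual.GaloisImage.InertiaDivisible
open Literature.NumberTheory.EllipticCurves.MazurRubin2015

namespace Summit.BirchSwinnertonDyer.Rank1Residual.X10.SelmerCompanionsTamagawaFree

/-! ### §1. `c_v ∣ Tam(E)` -/

section Bookkeeping

variable {K : Type} [Field K] [NumberField K] (W : WeierstrassCurve K) [W.IsElliptic]

/-- `c_v(E) ∣ Tam(E)`: the local Tamagawa number at a finite place `v` divides the Tamagawa product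
`∏ᶠ_v c_v(E)` (a `finprod` with finite support, `mulSupport_localTamagawaNumber_finite_holds`:
`c_v = 1` at the good places). [cite: SilvermanAEC2009, Cor. VII.6.2] -/
theorem localTamagawaNumber_dvd_tamagawaProduct (v : HeightOneSpectrum (𝓞 K)) :
    (W.baseChange (v.adicCompletion K)).localTamagawaNumber (v.adicCompletionIntegers K) ∣
      W.tamagawaProduct :=
  finprod_mem_dvd v W.mulSupport_localTamagawaNumber_finite_holds

/-- `p ∤ Tam(E) ⟹ p ∤ c_v(E)` at every finite place `v`. [cite: SilvermanAEC2009, Cor. VII.6.2] -/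
theorem not_dvd_localTamagawaNumber_of_not_dvd_tamagawaProduct {p : ℕ}
    (htam : ¬ p ∣ W.tamagawaProduct) (v : HeightOneSpectrum (𝓞 K)) :
    ¬ p ∣ (W.baseChange (v.adicCompletion K)).localTamagawaNumber (v.adicCompletionIntegers K) :=
  fun h ↦ htam (h.trans (localTamagawaNumber_dvd_tamagawaProduct W v))

end Bookkeeping

/-! ### §2. (C-i) over a number field: companions at Tamagawa-free level, fact-free off `p` -/

section General

variable {K : Type} [Field K] [NumberField K] (W W' : WeierstrassCurve K) [W.IsElliptic]
  [W'.IsElliptic] {p : ℕ} [Fact p.Prime]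

/-- **Selmer companions at Tamagawa-free places (number field, finite set `S`).** `p` odd,
`θ : E′[p] ⥲ E[p]` `Γ_K`-equivariant, `S` a finite set of finite places outside which both curves are
good and `v ∤ p`; at the places of `S` above `p` the local conditions agree along `θ` (hypothesis
`habove`), and at every place of `S` not above `p` both local Tamagawa numbers are prime to `p`
(ANY reduction types). Then `#Sel^(p)(E′/K) = #Sel^(p)(E/K)`: the agreement off `p` is n1011's
`selmerLocalKer_iff_h1Equiv_of_not_dvd_localTamagawaNumber` (Milne I.3.8: both conditions are the
unramified one), and the count is x10's `natCard_selmerGroup_eq_of_congr_of_agree`.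
[cite: MazurRubin2015SelmerCompanions, Thm. 3.1] [cite: MilneADT2006, Ch. I Prop. 3.8 and Remark 3.10]
[cite: MazurRubin2004, §2.3] -/
theorem natCard_selmerGroup_eq_of_congr_of_not_dvd_localTamagawaNumber (hp2 : p ≠ 2)
    (θ : geomTorsion W' (p : ℤ) ≃+ geomTorsion W (p : ℤ))
    (hθ : ∀ (σ : absoluteGaloisGroup K) (P : geomTorsion W' (p : ℤ)), θ (σ • P) = σ • θ P)
    (S : Finset (HeightOneSpectrum (𝓞 K)))
    (hS : ∀ v : HeightOneSpectrum (𝓞 K), v ∉ S →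
      W.HasGoodReductionAt v ∧ W'.HasGoodReductionAt v ∧ (p : 𝓞 K) ∉ v.asIdeal)
    (habove : ∀ v ∈ S, (p : 𝓞 K) ∈ v.asIdeal → ∀ c' : galH1Torsion W' (p : ℤ),
      c' ∈ selmerLocalKer W' (v.adicCompletion K) (p : ℤ) ↔
        h1Equiv θ hθ c' ∈ selmerLocalKer W (v.adicCompletion K) (p : ℤ))
    (hc : ∀ v ∈ S, (p : 𝓞 K) ∉ v.asIdeal →
      ¬ p ∣ (W.baseChange (v.adicCompletion K)).localTamagawaNumber (v.adicCompletionIntegers K))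
    (hc' : ∀ v ∈ S, (p : 𝓞 K) ∉ v.asIdeal →
      ¬ p ∣ (W'.baseChange (v.adicCompletion K)).localTamagawaNumber (v.adicCompletionIntegers K)) :
    Nat.card (W'.selmerGroup (p : ℤ)) = Nat.card (W.selmerGroup (p : ℤ)) := by
  -- the `iff` at every place of `S`: above `p` by hypothesis, elsewhere by (L1) on both sides
  have hiff : ∀ v ∈ S, ∀ c' : galH1Torsion W' (p : ℤ),
      c' ∈ selmerLocalKer W' (v.adicCompletion K) (p : ℤ) ↔
        h1Equiv θ hθ c' ∈ selmerLocalKer W (v.adicCompletion K) (p : ℤ) := by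
    intro v hv c'
    by_cases hpv : (p : 𝓞 K) ∈ v.asIdeal
    · exact habove v hv hpv c'
    · exact selmerLocalKer_iff_h1Equiv_of_not_dvd_localTamagawaNumber W p W' θ hθ v hpv
        (hc v hv hpv) (hc' v hv hpv) c'
  exact natCard_selmerGroup_eq_of_congr_of_agree W W' hp2 θ hθ S hS
    (fun v hv c hcm ↦ (hiff v hv c).mp hcm)
    (fun v hv c hcm ↦ symm_mem_selmerLocalKer_of_iff W W' θ hθ (hiff v hv) hcm)

/-- **Selmer companions at Tamagawa-free LEVEL (number field; no set `S`).** `p` odd,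
`θ : E′[p] ⥲ E[p]` `Γ_K`-equivariant, `p ∤ Tam(E)` and `p ∤ Tam(E′)`; at every place `v` above `p`
the local conditions agree along `θ` (hypothesis `habove` — e.g. both curves good above `p` with
`e(v|p) < p − 1`, Mazur–Rubin 2015 Thm. 3.1 (iv)(b)). Then `#Sel^(p)(E′/K) = #Sel^(p)(E/K)` — with NO
hypothesis on the reduction types off `p`: `S` := bad places of either curve ∪ places above `p`
(finite: `finite_badPlaces_holds`, `Ideal.finite_factors`), each place of `S` off `p` being
Tamagawa-free for both curves (`c_v ∣ Tam`). Fact-free.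
[cite: MazurRubin2015SelmerCompanions, Thm. 3.1] [cite: MilneADT2006, Ch. I Prop. 3.8 and Remark 3.10]
[cite: SilvermanAEC2009, Cor. VII.6.2] -/
theorem natCard_selmerGroup_eq_of_congr_of_not_dvd_tamagawaProduct (hp2 : p ≠ 2)
    (θ : geomTorsion W' (p : ℤ) ≃+ geomTorsion W (p : ℤ))
    (hθ : ∀ (σ : absoluteGaloisGroup K) (P : geomTorsion W' (p : ℤ)), θ (σ • P) = σ • θ P)
    (habove : ∀ v : HeightOneSpectrum (𝓞 K), (p : 𝓞 K) ∈ v.asIdeal →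
      ∀ c' : galH1Torsion W' (p : ℤ),
        c' ∈ selmerLocalKer W' (v.adicCompletion K) (p : ℤ) ↔
          h1Equiv θ hθ c' ∈ selmerLocalKer W (v.adicCompletion K) (p : ℤ))
    (htam : ¬ p ∣ W.tamagawaProduct) (htam' : ¬ p ∣ W'.tamagawaProduct) :
    Nat.card (W'.selmerGroup (p : ℤ)) = Nat.card (W.selmerGroup (p : ℤ)) := by
  have hpp : p.Prime := Fact.out
  -- the finite set `S` of bad places of either curve and of places above `p`
  have hI : Ideal.span {(p : 𝓞 K)} ≠ 0 := by
    rw [Ne, Ideal.zero_eq_bot, Ideal.span_singleton_eq_bot]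
    exact_mod_cast hpp.ne_zero
  set S : Finset (HeightOneSpectrum (𝓞 K)) :=
    (W.finite_badPlaces_holds (𝓞 K)).toFinset ∪ (W'.finite_badPlaces_holds (𝓞 K)).toFinset ∪
      (Ideal.finite_factors hI).toFinset with hSdef
  have hS : ∀ v : HeightOneSpectrum (𝓞 K), v ∉ S →
      W.HasGoodReductionAt v ∧ W'.HasGoodReductionAt v ∧ (p : 𝓞 K) ∉ v.asIdeal := by
    intro v hv
    rw [hSdef, Finset.mem_union, Finset.mem_union, Set.Finite.mem_toFinset,
      Set.Finite.mem_toFinset, Set.Finite.mem_toFinset, mem_badPlaces_iff, mem_badPlaces_iff,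
      Set.mem_setOf_eq, Ideal.dvd_span_singleton] at hv
    push Not at hv
    exact ⟨hv.1.1, hv.1.2, hv.2⟩
  exact natCard_selmerGroup_eq_of_congr_of_not_dvd_localTamagawaNumber W W' hp2 θ hθ S hS
    (fun v _ hpv ↦ habove v hpv)
    (fun v _ _ ↦ not_dvd_localTamagawaNumber_of_not_dvd_tamagawaProduct W htam v)
    (fun v _ _ ↦ not_dvd_localTamagawaNumber_of_not_dvd_tamagawaProduct W' htam' v)

/-! #### Consequences of the Selmer count (any number field; fact-free) -/

/-- `#Sel^(p)(E′/K) = 1 ⟹ rank E′(K) = 0 ∧ E′(K)[p] = 0 ∧ Ш(E′/K)[p^∞] = 0` — the exact descent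
sequence (Silverman X.4.2: `Sel^(p) = 0` forces `E′(K) = pE′(K)`, so rank `0` and no `p`-torsion,
tree `mordellWeilRank_eq_zero_and_torsionBy_eq_bot_of_selmerGroup_eq_bot`; and `Ш[p]` is the image of
`Sel^(p)`, tree `map_torsionH1ToH1_selmerGroup_holds`, so `Ш[p] = 0`, hence `Ш[p^∞] = 0`). Fact-free;
the shape of x10 GEN 28's `RankZeroOfTrivialPSelmer.rank_zero_of_natCard_selmerGroup_eq_one` (over `ℚ`)
with the torsion clause added. [cite: SilvermanAEC2009, Thm. X.4.2] -/
theorem rank_zero_of_natCard_selmerGroup_eq_one (h : Nat.card (W'.selmerGroup (p : ℤ)) = 1) :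
    W'.mordellWeilRank = 0 ∧ AddSubgroup.torsionBy W'.toAffine.Point (p : ℤ) = ⊥ ∧
      AddCommGroup.primaryComponent W'.sha p = ⊥ := by
  have hp0 : (p : ℤ) ≠ 0 := by exact_mod_cast (Fact.out : p.Prime).ne_zero
  have hbot : W'.selmerGroup (p : ℤ) = ⊥ := by
    haveI := (Nat.card_eq_one_iff_unique.mp h).1
    exact (W'.selmerGroup (p : ℤ)).eq_bot_of_subsingleton
  have hrt := mordellWeilRank_eq_zero_and_torsionBy_eq_bot_of_selmerGroup_eq_bot W' p hbot
  have hsha : (W'.sha ⊓ AddSubgroup.torsionBy W'.galH1 (p : ℤ) : AddSubgroup W'.galH1) = ⊥ := by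
    rw [← map_torsionH1ToH1_selmerGroup_holds W' hp0, hbot, AddSubgroup.map_bot]
  exact ⟨hrt.1, hrt.2, primaryComponent_sha_eq_bot_of_inf_torsionBy_eq_bot W' p hsha⟩

/-- `#Sel^(p)(E′/K) = n ∧ rank E′(K) = 0 ∧ #E′(K)[p] = 1 ⟹ #Ш(E′/K)[p] = n`, by the exact descent
count `#Sel^(p) = p^{rank} · #E′(K)[p] · #Ш[p]` (Silverman X.4.2, tree `natCard_selmerGroup_eq`).
Fact-free. [cite: SilvermanAEC2009, Thm. X.4.2] -/
theorem natCard_sha_torsion_eq_of_natCard_selmerGroup_eq_of_rank_zero {n : ℕ}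
    (hSel : Nat.card (W'.selmerGroup (p : ℤ)) = n) (hrank : W'.mordellWeilRank = 0)
    (htors : Nat.card (AddSubgroup.torsionBy W'.toAffine.Point (p : ℤ)) = 1) :
    Nat.card (W'.sha ⊓ AddSubgroup.torsionBy W'.galH1 (p : ℤ) : AddSubgroup W'.galH1) = n := by
  have hcount := W'.natCard_selmerGroup_eq (Fact.out : p.Prime).ne_zero
  rw [hSel, hrank, pow_zero, one_mul, htors, one_mul] at hcount
  exact hcount.symm

end General

/-! ### §3. (C-i) over `ℚ`: both curves good at `p`, the place `p` by Mazur–Rubin 2015 (`hMR`) -/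

section Rat

variable (W W' : WeierstrassCurve ℚ) [W.IsElliptic] [W'.IsElliptic] {p : ℕ} [hp : Fact p.Prime]

omit [W.IsElliptic] in
/-- Record vocabulary: an integral model `E₀` of `E = E₀ ⊗ ℚ` with `p ∤ Δ(E₀)` gives good reduction at
the place of `p` (`hasGoodReductionAt_map_of_not_dvd`; Silverman VII.5.1 (a)).
[cite: SilvermanAEC2009, VII.5 Prop. 5.1 (a)] -/
theorem hasGoodReductionAt_of_map_eq_of_not_dvd {E₀ : WeierstrassCurve ℤ}
    (hE : E₀.map (Int.castRingHom ℚ) = W) (hpE : ¬ (p : ℤ) ∣ E₀.Δ) (v : HeightOneSpectrum (𝓞 ℚ))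
    (hpv : (p : 𝓞 ℚ) ∈ v.asIdeal) : W.HasGoodReductionAt v := by
  have hv : (Rat.HeightOneSpectrum.primesEquiv v : ℕ) = p :=
    Rat.HeightOneSpectrum.primesEquiv_eq_of_natCast_mem v hp.out hpv
  rw [← hE]
  exact hasGoodReductionAt_map_of_not_dvd E₀ v (by rw [hv]; exact hpE)

/-- **(C-i) Selmer companions over `ℚ` at Tamagawa-free level.** `p` an odd prime,
`θ : E′[p] ⥲ E[p]` a `Γ_ℚ`-isomorphism, both curves of GOOD reduction at `p`, `p ∤ Tam(E)` and
`p ∤ Tam(E′)` (`Tam = ∏_ℓ c_ℓ`). Then **`#Sel^(p)(E′/ℚ) = #Sel^(p)(E/ℚ)`**. The agreement at `p` is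
Mazur–Rubin 2015 Thm. 3.1 (iv)(b) (`e(ℚ_p/ℚ_p) = 1 < p − 1`), the named fact `hMR`
(`selmerLocalKer_iff_of_goodReduction_above_rat`); off `p` it is (L1) at a place Tamagawa-free for
both curves (n1011 row T-URTAM), with no reduction-type hypothesis. CONDITIONAL on `hMR`. N2 use
(`p = 3`): `E` an N2 cell and `A` ANY curve with `A[3] ≅ E[3]`, good at `3`, `3 ∤ ∏ c_ℓ(A)`,
`3 ∤ ∏ c_ℓ(E)`: `#Sel₃(A) = #Sel₃(E)` (memo TRIVIAL-ROADS (X); census 175/175 + > 2 000 Hesse members,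
0 violations). [cite: MazurRubin2015SelmerCompanions, Thm. 3.1 (iv)(b)]
[cite: MilneADT2006, Ch. I Prop. 3.8 and Remark 3.10] [cite: SilvermanAEC2009, Cor. VII.6.2] -/
theorem natCard_selmerGroup_eq_of_congr_of_not_dvd_tamagawaProduct_rat
    (hMR : selmerLocalKer_iff_of_goodReduction_above) (hp2 : p ≠ 2)
    (θ : geomTorsion W' (p : ℤ) ≃+ geomTorsion W (p : ℤ))
    (hθ : ∀ (σ : absoluteGaloisGroup ℚ) (P : geomTorsion W' (p : ℤ)), θ (σ • P) = σ • θ P)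
    (hgood : ∀ v : HeightOneSpectrum (𝓞 ℚ), (p : 𝓞 ℚ) ∈ v.asIdeal →
      W.HasGoodReductionAt v ∧ W'.HasGoodReductionAt v)
    (htam : ¬ p ∣ W.tamagawaProduct) (htam' : ¬ p ∣ W'.tamagawaProduct) :
    Nat.card (W'.selmerGroup (p : ℤ)) = Nat.card (W.selmerGroup (p : ℤ)) :=
  natCard_selmerGroup_eq_of_congr_of_not_dvd_tamagawaProduct W W' hp2 θ hθ
    (fun v hpv c' ↦ selmerLocalKer_iff_of_goodReduction_above_rat hMR W W' hp2 θ hθ v hpv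
      (hgood v hpv).1 (hgood v hpv).2 c')
    htam htam'

/-- **(C-i) in the record vocabulary: integer models with `p ∤ Δ`.** `E = E₀ ⊗ ℚ`, `E′ = F₀ ⊗ ℚ` for
integral Weierstrass models with `p ∤ Δ(E₀)`, `p ∤ Δ(F₀)` (so both are good at `p`,
`hasGoodReductionAt_map_of_not_dvd`), `p` odd, `θ : E′[p] ⥲ E[p]`, `p ∤ Tam(E)`, `p ∤ Tam(E′)` ⟹
`#Sel^(p)(E′/ℚ) = #Sel^(p)(E/ℚ)`. CONDITIONAL on `hMR`.
[cite: MazurRubin2015SelmerCompanions, Thm. 3.1 (iv)(b)] [cite: MilneADT2006, Ch. I Prop. 3.8 and Remark 3.10]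
[cite: SilvermanAEC2009, VII.5 Prop. 5.1 (a) and Cor. VII.6.2] -/
theorem natCard_selmerGroup_eq_of_congr_of_not_dvd_tamagawaProduct_of_map
    (hMR : selmerLocalKer_iff_of_goodReduction_above) (hp2 : p ≠ 2)
    {E₀ F₀ : WeierstrassCurve ℤ} (hE : E₀.map (Int.castRingHom ℚ) = W)
    (hF : F₀.map (Int.castRingHom ℚ) = W') (hpE : ¬ (p : ℤ) ∣ E₀.Δ) (hpF : ¬ (p : ℤ) ∣ F₀.Δ)
    (θ : geomTorsion W' (p : ℤ) ≃+ geomTorsion W (p : ℤ))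
    (hθ : ∀ (σ : absoluteGaloisGroup ℚ) (P : geomTorsion W' (p : ℤ)), θ (σ • P) = σ • θ P)
    (htam : ¬ p ∣ W.tamagawaProduct) (htam' : ¬ p ∣ W'.tamagawaProduct) :
    Nat.card (W'.selmerGroup (p : ℤ)) = Nat.card (W.selmerGroup (p : ℤ)) :=
  natCard_selmerGroup_eq_of_congr_of_not_dvd_tamagawaProduct_rat W W' hMR hp2 θ hθ
    (fun v hpv ↦ ⟨hasGoodReductionAt_of_map_eq_of_not_dvd W hE hpE v hpv,
      hasGoodReductionAt_of_map_eq_of_not_dvd W' hF hpF v hpv⟩) htam htam'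

/-! ### §4. (C-iii) the UNIT road transfers: `Sel^(p)(E) = 0 ⟹ Sel^(p)(E′) = 0 ⟹ rank 0, Ш[p^∞] = 0` -/

/-- **(C-iii) A unit cell makes every Tamagawa-free good-at-`p` congruent curve a unit curve
(Selmer level).** Under the hypotheses of (C-i) over `ℚ`, `#Sel^(p)(E/ℚ) = 1 ⟹ #Sel^(p)(E′/ℚ) = 1`.
CONDITIONAL on `hMR`. [cite: MazurRubin2015SelmerCompanions, Thm. 3.1 (iv)(b)]
[cite: MilneADT2006, Ch. I Prop. 3.8 and Remark 3.10] -/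
theorem natCard_selmerGroup_eq_one_of_congr_of_not_dvd_tamagawaProduct_rat
    (hMR : selmerLocalKer_iff_of_goodReduction_above) (hp2 : p ≠ 2)
    (θ : geomTorsion W' (p : ℤ) ≃+ geomTorsion W (p : ℤ))
    (hθ : ∀ (σ : absoluteGaloisGroup ℚ) (P : geomTorsion W' (p : ℤ)), θ (σ • P) = σ • θ P)
    (hgood : ∀ v : HeightOneSpectrum (𝓞 ℚ), (p : 𝓞 ℚ) ∈ v.asIdeal →
      W.HasGoodReductionAt v ∧ W'.HasGoodReductionAt v)
    (htam : ¬ p ∣ W.tamagawaProduct) (htam' : ¬ p ∣ W'.tamagawaProduct)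
    (hSel : Nat.card (W.selmerGroup (p : ℤ)) = 1) :
    Nat.card (W'.selmerGroup (p : ℤ)) = 1 := by
  rw [natCard_selmerGroup_eq_of_congr_of_not_dvd_tamagawaProduct_rat W W' hMR hp2 θ hθ hgood htam
    htam', hSel]

/-- **(C-iii) THE UNIT ROAD ALONG TAMAGAWA-FREE CONGRUENCES.** `p` an odd prime; `E/ℚ` with
`#Sel^(p)(E/ℚ) = 1` (a UNIT cell: certified full `p`-descent); `E′/ℚ` ANY curve with a
`Γ_ℚ`-isomorphism `θ : E′[p] ⥲ E[p]`, both curves good at `p`, `p ∤ Tam(E)`, `p ∤ Tam(E′)`. Then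
**`rank E′(ℚ) = 0`, `E′(ℚ)[p] = 0` and `Ш(E′/ℚ)[p^∞] = 0`** — `E′` is a unit curve too. N2 reading
(`p = 3`): for each of the 77 UNIT cells `E` of N2 (TRIVIAL-ROADS memo §3: `T_E = ∅`, `Sel₃(E) = 0`),
every Tamagawa-`3`-free good-at-`3` curve `3`-congruent to `E` — in Cremona's table or beyond it (the
dual Hesse families, memo §4: > 2 000 members found, conductors to `10^28`) — has rank `0` and
`Ш[3^∞] = 0`. CONDITIONAL on `hMR`; `θ` is EVIDENCE per pair. Nothing booked.
[cite: MazurRubin2015SelmerCompanions, Thm. 3.1 (iv)(b)] [cite: MilneADT2006, Ch. I Prop. 3.8 and Remark 3.10]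
[cite: SilvermanAEC2009, Thm. X.4.2] -/
theorem rank_zero_of_congr_of_natCard_selmerGroup_eq_one_rat
    (hMR : selmerLocalKer_iff_of_goodReduction_above) (hp2 : p ≠ 2)
    (θ : geomTorsion W' (p : ℤ) ≃+ geomTorsion W (p : ℤ))
    (hθ : ∀ (σ : absoluteGaloisGroup ℚ) (P : geomTorsion W' (p : ℤ)), θ (σ • P) = σ • θ P)
    (hgood : ∀ v : HeightOneSpectrum (𝓞 ℚ), (p : 𝓞 ℚ) ∈ v.asIdeal →
      W.HasGoodReductionAt v ∧ W'.HasGoodReductionAt v)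
    (htam : ¬ p ∣ W.tamagawaProduct) (htam' : ¬ p ∣ W'.tamagawaProduct)
    (hSel : Nat.card (W.selmerGroup (p : ℤ)) = 1) :
    W'.mordellWeilRank = 0 ∧ AddSubgroup.torsionBy W'.toAffine.Point (p : ℤ) = ⊥ ∧
      AddCommGroup.primaryComponent W'.sha p = ⊥ := by
  obtain ⟨h₁, h₂, h₃⟩ := rank_zero_of_natCard_selmerGroup_eq_one W'
    (natCard_selmerGroup_eq_one_of_congr_of_not_dvd_tamagawaProduct_rat W W' hMR hp2 θ hθ hgood htam
      htam' hSel)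
  -- `E′(ℚ)` carries `ℚ`'s decidable equality here, the classical one in the general lemma (`convert`)
  exact ⟨h₁, by convert h₂, h₃⟩

/-- (C-iii) in the record vocabulary (integer models, `p ∤ Δ(E₀)`, `p ∤ Δ(F₀)`). CONDITIONAL on `hMR`.
[cite: MazurRubin2015SelmerCompanions, Thm. 3.1 (iv)(b)] [cite: SilvermanAEC2009, Thm. X.4.2] -/
theorem rank_zero_of_congr_of_natCard_selmerGroup_eq_one_of_map
    (hMR : selmerLocalKer_iff_of_goodReduction_above) (hp2 : p ≠ 2)
    {E₀ F₀ : WeierstrassCurve ℤ} (hE : E₀.map (Int.castRingHom ℚ) = W)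
    (hF : F₀.map (Int.castRingHom ℚ) = W') (hpE : ¬ (p : ℤ) ∣ E₀.Δ) (hpF : ¬ (p : ℤ) ∣ F₀.Δ)
    (θ : geomTorsion W' (p : ℤ) ≃+ geomTorsion W (p : ℤ))
    (hθ : ∀ (σ : absoluteGaloisGroup ℚ) (P : geomTorsion W' (p : ℤ)), θ (σ • P) = σ • θ P)
    (htam : ¬ p ∣ W.tamagawaProduct) (htam' : ¬ p ∣ W'.tamagawaProduct)
    (hSel : Nat.card (W.selmerGroup (p : ℤ)) = 1) :
    W'.mordellWeilRank = 0 ∧ AddSubgroup.torsionBy W'.toAffine.Point (p : ℤ) = ⊥ ∧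
      AddCommGroup.primaryComponent W'.sha p = ⊥ :=
  rank_zero_of_congr_of_natCard_selmerGroup_eq_one_rat W W' hMR hp2 θ hθ
    (fun v hpv ↦ ⟨hasGoodReductionAt_of_map_eq_of_not_dvd W hE hpE v hpv,
      hasGoodReductionAt_of_map_eq_of_not_dvd W' hF hpF v hpv⟩) htam htam' hSel

/-! ### §5. (C-ii) the Ш-cell NO-GO: `#Sel^(p)(E) ≠ 1 ⟹` no Tamagawa-free good-at-`p` congruent unit curve -/

/-- **(C-ii) NO unit partner.** Under the hypotheses of (C-i) over `ℚ`, if `#Sel^(p)(E/ℚ) ≠ 1` then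
`#Sel^(p)(E′/ℚ) ≠ 1`: no Tamagawa-`p`-free good-at-`p` curve `p`-congruent to `E` is a unit curve. N2
reading: the six Ш-cells (`dim Sel₃(E) = 2` EXACT, `T_E = ∅`) and the 25 parity cells have no unit
partner in Cremona's table or anywhere (memo §3 NOGO-sha; for NOGO-parity the census binder is
`dim Sel₃ = 1`). CONDITIONAL on `hMR`. [cite: MazurRubin2015SelmerCompanions, Thm. 3.1 (iv)(b)]
[cite: MilneADT2006, Ch. I Prop. 3.8 and Remark 3.10] -/
theorem natCard_selmerGroup_ne_one_of_congr_rat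
    (hMR : selmerLocalKer_iff_of_goodReduction_above) (hp2 : p ≠ 2)
    (θ : geomTorsion W' (p : ℤ) ≃+ geomTorsion W (p : ℤ))
    (hθ : ∀ (σ : absoluteGaloisGroup ℚ) (P : geomTorsion W' (p : ℤ)), θ (σ • P) = σ • θ P)
    (hgood : ∀ v : HeightOneSpectrum (𝓞 ℚ), (p : 𝓞 ℚ) ∈ v.asIdeal →
      W.HasGoodReductionAt v ∧ W'.HasGoodReductionAt v)
    (htam : ¬ p ∣ W.tamagawaProduct) (htam' : ¬ p ∣ W'.tamagawaProduct)
    (hSel : Nat.card (W.selmerGroup (p : ℤ)) ≠ 1) :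
    Nat.card (W'.selmerGroup (p : ℤ)) ≠ 1 := by
  rwa [natCard_selmerGroup_eq_of_congr_of_not_dvd_tamagawaProduct_rat W W' hMR hp2 θ hθ hgood htam
    htam']

/-- **(C-ii) SHARP FORM — the Ш-cells as MACHINES for `Ш[p] ≅ (ℤ/p)²`.** `p` odd; `E/ℚ` with
`#Sel^(p)(E/ℚ) = p²` and `E[p]` IRREDUCIBLE; `E′/ℚ` with `θ : E′[p] ⥲ E[p]` `Γ_ℚ`-equivariant, both
good at `p`, `p ∤ Tam(E)`, `p ∤ Tam(E′)`, and `rank E′(ℚ) = 0`. Then **`#Ш(E′/ℚ)[p] = p²`**: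
`#Sel^(p)(E′) = p²` by (C-i); `E′[p]` is irreducible (transport along `θ⁻¹`,
`Mazur1978.hasIrreducibleModPGaloisRep_of_addEquiv`), so `E′(ℚ)[p] = 0`
(`natCard_torsionBy_eq_one_of_hasIrreducibleModPGaloisRep`); then Silverman X.4.2. N2 reading
(`p = 3`, memo (C4)): every rank-`0` Tamagawa-`3`-free good-at-`3` curve `3`-congruent to one of the six
Ш-cells has `Ш[3] ≅ (ℤ/3)²` — e.g. the new conductor-`10¹³` members of the dual Hesse families of
`453152bq1` / `264992dm1` with `Ш_an = 9, 9, 9, 225` (memo §4). CONDITIONAL on `hMR`; `θ` and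
`rank E′(ℚ) = 0` are EVIDENCE per pair. [cite: MazurRubin2015SelmerCompanions, Thm. 3.1 (iv)(b)]
[cite: MilneADT2006, Ch. I Prop. 3.8 and Remark 3.10] [cite: SilvermanAEC2009, Thm. X.4.2] -/
theorem natCard_sha_torsion_eq_sq_of_congr_of_rank_zero_rat
    (hMR : selmerLocalKer_iff_of_goodReduction_above) (hp2 : p ≠ 2)
    (θ : geomTorsion W' (p : ℤ) ≃+ geomTorsion W (p : ℤ))
    (hθ : ∀ (σ : absoluteGaloisGroup ℚ) (P : geomTorsion W' (p : ℤ)), θ (σ • P) = σ • θ P)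
    (hgood : ∀ v : HeightOneSpectrum (𝓞 ℚ), (p : 𝓞 ℚ) ∈ v.asIdeal →
      W.HasGoodReductionAt v ∧ W'.HasGoodReductionAt v)
    (htam : ¬ p ∣ W.tamagawaProduct) (htam' : ¬ p ∣ W'.tamagawaProduct)
    (hirr : W.HasIrreducibleModPGaloisRep p)
    (hSel : Nat.card (W.selmerGroup (p : ℤ)) = p ^ 2) (hrank : W'.mordellWeilRank = 0) :
    Nat.card (W'.sha ⊓ AddSubgroup.torsionBy W'.galH1 (p : ℤ) : AddSubgroup W'.galH1) = p ^ 2 := by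
  have hirr' : W'.HasIrreducibleModPGaloisRep p :=
    Mazur1978.hasIrreducibleModPGaloisRep_of_addEquiv θ.symm (symm_equivariant θ hθ) hirr
  have hSel' : Nat.card (W'.selmerGroup (p : ℤ)) = p ^ 2 := by
    rw [natCard_selmerGroup_eq_of_congr_of_not_dvd_tamagawaProduct_rat W W' hMR hp2 θ hθ hgood htam
      htam', hSel]
  -- `E′(ℚ)[p] = 0` from irreducibility (`ℚ`'s decidable equality vs the classical one: `convert`)
  exact natCard_sha_torsion_eq_of_natCard_selmerGroup_eq_of_rank_zero W' hSel' hrank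
    (by convert natCard_torsionBy_eq_one_of_hasIrreducibleModPGaloisRep W' p hirr')

end Rat

end Summit.BirchSwinnertonDyer.Rank1Residual.X10.SelmerCompanionsTamagawaFree

end
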